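import Summits.KontsevichZagierPeriods.KontsevichZagierPeriods.Theorems.LinRedNormalFormHoffmanSpanInKZSpanTransfer
import Summits.KontsevichZagierPeriods.KontsevichZagierPeriods.Theorems.LinRedNormalFormHoffmanIndependenceZagierEquivalence

/-!
# Crux `LinRedNormalForm.HoffmanIndependence` (stmt-KontsevichZagierPeriods-15045), line `weight_split`,
# cycle 4: the REAL SPANNING BRIDGE from the sister crux `HoffmanSpanInKZ` — Brown-free

The route `LinRedNormalForm` carries two MZV cruxes: `HoffmanSpanInKZ` (item #6,
stmt-KontsevichZagierPeriods-15044: every MZV word representation is congruent MODULO THE MOVES OF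
THE KZ CALCULUS to a `ℤ`-combination of Hoffman word representations of the same weight — a
statement about formal integral representations, attacked weight by weight through kernel-checked
extended-double-shuffle certificates) and `HoffmanIndependence` (item #7, this crux: the real
Hoffman values are `ℚ`-linearly independent — the declared transcendence input).

This file proves the bridge between them, with NO motivic input:

* `multipleZeta_mem_hoffmanSpan_of_spanAt` / `hoffmanSpan_eq_mzvSpace_of_spanAt`: the weight-`N`
  slice `SpanAt N` of crux #6 implies Brown's theorem in weight `N` for REAL numbers,
  `hoffmanSpan N = mzvSpace N`. Proof: apply `SpanAt N` to the canonical word representation of an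
  admissible index `s`; evaluate with `KZ.eval`; the relation part evaluates to `0` by the
  SOUNDNESS OF THE KZ CALCULUS (`KZ.relations_le_ker_eval_holds`), the word representation to `ζ(s)`
  by KONTSEVICH'S FORMULA (`KZ.mzvRep_value_holds`), and every Hoffman generator `[Δ, q'·ω_u]` to
  `q'·ζ(u) ∈ hoffmanSpan N`;
* hence `hoffmanSpan_eq_mzvSpace_of_hoffmanSpanInKZ : HoffmanSpanInKZ → hoffmanSpan_eq_mzvSpace`
  (crux #6 ⟹ Brown's Theorem 1.1 in its real form ⟹ the Terasoma–Deligne–Goncharov bound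
  `dim_ℚ 𝒵_n ≤ d_n`, `finrank_mzvSpace_le_zagierDim_of_hoffmanSpanInKZ`), and
* **`hoffmanIndependence_iff_zagierConjecture_of_hoffmanSpanInKZ :
  HoffmanSpanInKZ → (HoffmanIndependence ↔ ZagierConjecture)`** — inside the route, without Brown's
  motivic theorem, the declared transcendence input #7 is EXACTLY Zagier's printed conjecture
  (dimension conjecture ∧ weight grading); in particular
  `hoffmanIndependence_of_hoffmanSpanInKZ_of_zagierConjecture : HoffmanSpanInKZ → ZagierConjecture →
  HoffmanIndependence` (the route may take `ZagierConjecture` verbatim as its transcendence input);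
* per weight: `inWeight_iff_finrank_mzvSpace_eq_of_spanAt` (the weight-`n` slice of the registered
  stub `stub_inWeight` is exactly `dim_ℚ 𝒵_n = d_n` wherever `SpanAt n` is known) and
  `finrank_mzvSpace_eq_of_hoffmanIndependence_of_spanAt`.

The unconditional instances (weights `≤ 11`, from the landed certificates of line 15044/`Sketch`)
are in the companion file `…HoffmanIndependenceLeEleven.lean`.

Sources: M. Kontsevich, D. Zagier, *Periods* (2001), §1.1 (the formula), §1.2 (the rules);
F. Brown, Ann. of Math. 175 (2012), Thm 1.1; T. Terasoma, Invent. Math. 149 (2002), Thm 1.2;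
D. Zagier, ECM 1992 (1994), §9; A. B. Goncharov, ECM 2000 (2001), Conj. 1.1.
-/

noncomputable section

namespace Summit.KontsevichZagierPeriods.LinRedNormalForm.HoffmanIndependence

open Set MeasureTheory
open Literature.NumberTheory.Transcendental MZV
open Summit.KontsevichZagierPeriods.MzvKernelInKZ.Negative
open Summit.KontsevichZagierPeriods.MzvKernelInKZ.TwoPosets
open Summit.KontsevichZagierPeriods.LinRedNormalForm.HoffmanSpanInKZ
  (hoffmanGens SpanAt hoffmanSpanInKZ_iff spanAt_of_edsCertificate)
open Summit.KontsevichZagierPeriods.KontsevichZagierPeriods.Theses.LinRedNormalForm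
  (HoffmanIndependence HoffmanSpanInKZ)

/-! ## Evaluation of the Hoffman generators -/

/-- **Kontsevich's formula for a Hoffman generator.** A representation on the open ordered simplex
whose integrand agrees there with `q · ∏ ω_{εᵢ}` for the binary word of an admissible index `u`
has value `q · ζ(u)` (`KZ.mzvRep_value_holds`, after replacing the integrand on the domain).
[cite: KontsevichZagier2001, §1.1] -/
theorem value_eq_mul_multipleZeta_of_eqOn {u : List ℕ} (hu : IsAdmissible u) {q : ℚ}
    (s' : KZ.IntegralRep (weight u))
    (hd : s'.domain = {t | (∀ i, 0 < t i) ∧ (∀ i, t i < 1) ∧ StrictAnti t})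
    (hi : EqOn s'.integrand (fun t => (q : ℝ) * KZ.mzvIntegrand u t) s'.domain) :
    s'.value = (q : ℝ) * multipleZeta u := by
  rw [← KZ.mzvRep_value_holds u hu (KZ.mzvIntegrand_isSemialgebraicFunOn_holds u)
      (KZ.mzvIntegrand_integrableOn_holds u hu), KZ.mzvRep_value_eq, ← integral_const_mul]
  have hm : MeasurableSet s'.domain := by
    rw [hd]
    exact KZ.measurableSet_openOrderedSimplex _
  unfold KZ.IntegralRep.value
  rw [setIntegral_congr_fun hm hi, hd]
  rfl

/-- Every Hoffman generator of weight `N` (a class `[Δ, q'·ω_u]`, `u ∈ {2,3}^×`, `|u| = N`)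
evaluates into the real Hoffman span of weight `N`. [cite: KontsevichZagier2001, §1.1] -/
theorem eval_mem_hoffmanSpan_of_mem_hoffmanGens {N : ℕ} {x : KZ.FormalRep}
    (hx : x ∈ hoffmanGens N) : KZ.eval x ∈ hoffmanSpan N := by
  obtain ⟨u, q', s', hu, hw, hd, hi, rfl⟩ := hx
  rw [KZ.eval_of, value_eq_mul_multipleZeta_of_eqOn hu.isAdmissible s' hd hi, ← Rat.smul_def]
  exact Submodule.smul_mem _ _ (Submodule.subset_span ⟨u, hu, hw, rfl⟩)

/-- Everything in the subgroup generated by the Hoffman generators of weight `N` evaluates into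
the real Hoffman span of weight `N` (`KZ.eval` is additive). [folklore] -/
theorem eval_mem_hoffmanSpan_of_mem_closure {N : ℕ} {m : KZ.FormalRep}
    (hm : m ∈ AddSubgroup.closure (hoffmanGens N)) : KZ.eval m ∈ hoffmanSpan N := by
  induction hm using AddSubgroup.closure_induction with
  | mem x hx => exact eval_mem_hoffmanSpan_of_mem_hoffmanGens hx
  | zero => simp
  | add x y _ _ hx hy =>
    rw [map_add]
    exact add_mem hx hy
  | neg x _ hx =>
    rw [map_neg]
    exact neg_mem hx

/-! ## The bridge: `SpanAt N` ⟹ Brown's theorem in weight `N`, for real numbers -/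

/-- **Real spanning from the formal slice.** If every MZV word representation of weight `N` is
congruent modulo the KZ moves to a combination of Hoffman generators (`SpanAt N`), then every real
MZV `ζ(s)` of weight `N` is a rational combination of real Hoffman values of weight `N`:
evaluate the congruence (soundness `KZ.relations_le_ker_eval_holds`; Kontsevich's formula for the
word representation, `value_wordRep_eq_multipleZeta`). [cite: KontsevichZagier2001, §1.2] [cite: Brown2012, Theorem 1.1] -/
theorem multipleZeta_mem_hoffmanSpan_of_spanAt {N : ℕ} (h : SpanAt N) {s : List ℕ}
    (hs : IsAdmissible s) (hw : weight s = N) : multipleZeta s ∈ hoffmanSpan N := by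
  subst hw
  have hε : Adm (bword (weight s) s) := adm_bword hs
  obtain ⟨m, hm, hrel⟩ := h (bword (weight s) s) 1 (wordRep (bword (weight s) s) 1 hε) rfl
    (fun t _ => rfl)
  have h0 : KZ.eval (KZ.of (wordRep (bword (weight s) s) 1 hε) - m) = 0 :=
    AddMonoidHom.mem_ker.1 (KZ.relations_le_ker_eval_holds hrel)
  rw [map_sub, sub_eq_zero, KZ.eval_of,
    value_wordRep_eq_multipleZeta s hs (bword (weight s) s) hε (fun _ => rfl)] at h0
  rw [h0]
  exact eval_mem_hoffmanSpan_of_mem_closure hm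

/-- **`SpanAt N` ⟹ Brown's theorem in weight `N` (real form): `hoffmanSpan N = mzvSpace N`.**
[cite: Brown2012, Theorem 1.1] [cite: KontsevichZagier2001, §1.2] -/
theorem hoffmanSpan_eq_mzvSpace_of_spanAt {N : ℕ} (h : SpanAt N) : hoffmanSpan N = mzvSpace N :=
  hoffmanSpan_eq_mzvSpace_of_forall_mem fun _ hs hw => multipleZeta_mem_hoffmanSpan_of_spanAt h hs hw

/-- An EDS certificate in weight `N` (all calculus stubs of line 15044 being landed,
`spanAt_of_edsCertificate`) gives Brown's theorem in weight `N` for real numbers.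
[cite: Brown2012, Theorem 1.1] [cite: IharaKanekoZagier2006, §1] -/
theorem hoffmanSpan_eq_mzvSpace_of_edsCertificate {N : ℕ} (hE : EdsCertificate N) :
    hoffmanSpan N = mzvSpace N :=
  hoffmanSpan_eq_mzvSpace_of_spanAt (spanAt_of_edsCertificate hE)

/-- `SpanAt n` ⟹ the Terasoma–Deligne–Goncharov bound in weight `n`: `dim_ℚ 𝒵_n ≤ d_n`.
[cite: Terasoma2002, Theorem 1.2] [cite: Brown2012, Theorem 1.1] -/
theorem finrank_mzvSpace_le_zagierDim_of_spanAt {n : ℕ} (h : SpanAt n) :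
    Module.finrank ℚ (mzvSpace n) ≤ zagierDim n :=
  finrank_mzvSpace_le_zagierDim_of_eq (hoffmanSpan_eq_mzvSpace_of_spanAt h)

/-! ## Crux #6 ⟹ Brown's theorem; the crux ⟺ Zagier's conjecture, Brown-free inside the route -/

/-- **Crux `HoffmanSpanInKZ` ⟹ Brown's theorem (Hoffman's Conjecture 2) for real MZVs**: the
named fact `hoffmanSpan_eq_mzvSpace` (`∀ n, hoffmanSpan n = mzvSpace n`) follows from the sister
crux by evaluation — no mixed Tate motives. [cite: Brown2012, Theorem 1.1] [cite: KontsevichZagier2001, §1.2] -/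
theorem hoffmanSpan_eq_mzvSpace_of_hoffmanSpanInKZ (h : HoffmanSpanInKZ) : hoffmanSpan_eq_mzvSpace :=
  fun N => hoffmanSpan_eq_mzvSpace_of_spanAt (hoffmanSpanInKZ_iff.1 h N)

/-- Crux `HoffmanSpanInKZ` ⟹ the Terasoma–Deligne–Goncharov upper bound `dim_ℚ 𝒵_n ≤ d_n` for all
`n` (the named fact `finrank_mzvSpace_le_zagierDim`). [cite: Terasoma2002, Theorem 1.2] -/
theorem finrank_mzvSpace_le_zagierDim_of_hoffmanSpanInKZ (h : HoffmanSpanInKZ) :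
    finrank_mzvSpace_le_zagierDim :=
  finrank_mzvSpace_le_zagierDim_of_hoffmanSpan_eq (hoffmanSpan_eq_mzvSpace_of_hoffmanSpanInKZ h)

/-- **Given crux #6, the crux IS Zagier's conjecture — with no motivic input.** Under
`HoffmanSpanInKZ`, `HoffmanIndependence ↔ ZagierConjecture` (`= ZagierDimensionConjecture ∧
MZVWeightGradingConjecture`): the equivalence `hoffmanIndependence_iff_zagierConjecture` needed
Brown's theorem `hoffmanSpan_eq_mzvSpace`, which crux #6 supplies
(`hoffmanSpan_eq_mzvSpace_of_hoffmanSpanInKZ`). So the route's declared transcendence input #7 is,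
inside the route, exactly the printed conjecture. [cite: Zagier1994, §9] [cite: GoncharovECM2001, Conjecture 1.1] -/
theorem hoffmanIndependence_iff_zagierConjecture_of_hoffmanSpanInKZ : HoffmanSpanInKZ → (HoffmanIndependence ↔ ZagierConjecture) :=
  fun h => hoffmanIndependence_iff_zagierConjecture (hoffmanSpan_eq_mzvSpace_of_hoffmanSpanInKZ h)

/-- **The crux from crux #6 and Zagier's conjecture** (Brown-free): the route may take
`ZagierConjecture` verbatim as its one transcendence input. [cite: Zagier1994, §9] [cite: GoncharovECM2001, Conjecture 1.1] -/
theorem hoffmanIndependence_of_hoffmanSpanInKZ_of_zagierConjecture (h : HoffmanSpanInKZ)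
    (hZ : ZagierConjecture) : HoffmanIndependence :=
  (hoffmanIndependence_iff_zagierConjecture_of_hoffmanSpanInKZ h).2 hZ

/-- Conversely, crux #6 and crux #7 together prove Zagier's conjecture (both halves).
[cite: Zagier1994, §9] [cite: GoncharovECM2001, Conjecture 1.1] -/
theorem zagierConjecture_of_hoffmanSpanInKZ_of_hoffmanIndependence (h : HoffmanSpanInKZ)
    (hI : HoffmanIndependence) : ZagierConjecture :=
  (hoffmanIndependence_iff_zagierConjecture_of_hoffmanSpanInKZ h).1 hI

/-- Given crux #6, the registered stub `stub_weightGrading` (`iSupIndep hoffmanSpan`) IS Goncharov's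
weight-grading conjecture for the full MZV spaces. [cite: GoncharovECM2001, Conjecture 1.1] -/
theorem weightGrading_iff_gradingConjecture_of_hoffmanSpanInKZ (h : HoffmanSpanInKZ) :
    iSupIndep hoffmanSpan ↔ MZVWeightGradingConjecture :=
  weightGrading_iff_gradingConjecture (hoffmanSpan_eq_mzvSpace_of_hoffmanSpanInKZ h)

/-- Given crux #6, the registered stub `stub_inWeight` (independence within each weight) IS
Zagier's dimension conjecture. [cite: Zagier1994, §9] -/
theorem inWeight_iff_zagierDimensionConjecture_of_hoffmanSpanInKZ (h : HoffmanSpanInKZ) :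
    (∀ n : ℕ, LinearIndependent ℚ
        (fun u : {u : List ℕ // IsHoffman u ∧ weight u = n} => multipleZeta u.1)) ↔
      ZagierDimensionConjecture :=
  inWeight_iff_zagierDimensionConjecture (hoffmanSpan_eq_mzvSpace_of_hoffmanSpanInKZ h)

/-! ## Per weight -/

/-- Wherever the slice `SpanAt n` of crux #6 is known, the weight-`n` slice of `stub_inWeight` is
EXACTLY Zagier's dimension statement `dim_ℚ 𝒵_n = d_n` in that weight. [cite: Zagier1994, §9] -/
theorem inWeight_iff_finrank_mzvSpace_eq_of_spanAt {n : ℕ} (h : SpanAt n) :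
    LinearIndependent ℚ
        (fun u : {u : List ℕ // IsHoffman u ∧ weight u = n} => multipleZeta u.1) ↔
      Module.finrank ℚ (mzvSpace n) = zagierDim n :=
  inWeight_iff_finrank_mzvSpace_eq_of_hoffmanSpan_eq (hoffmanSpan_eq_mzvSpace_of_spanAt h)

/-- Wherever `SpanAt n` is known, the crux gives Zagier's dimension `dim_ℚ 𝒵_n = d_n` outright
(lower bound from the crux, `zagierDim_le_finrank_mzvSpace_of_hoffmanIndependence`; upper bound
from the slice). [cite: Zagier1994, §9] -/
theorem finrank_mzvSpace_eq_of_hoffmanIndependence_of_spanAt (hI : HoffmanIndependence) {n : ℕ}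
    (h : SpanAt n) : Module.finrank ℚ (mzvSpace n) = zagierDim n :=
  le_antisymm (finrank_mzvSpace_le_zagierDim_of_spanAt h)
    (zagierDim_le_finrank_mzvSpace_of_hoffmanIndependence hI n)

end Summit.KontsevichZagierPeriods.LinRedNormalForm.HoffmanIndependence
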